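import Summits.ValiantsHypothesis.ValiantsHypothesis.Theorems.KPlusLogSqLawTropicalBWalkHalving

/-!
# Route `KPlusLogSqLaw`, crux `TropicalB` — SERIES and PARALLEL composition of parametric line families are ADDITIVE

HONEST FRAMING.  Helper file (seat val-sym-trop-p1 g5, cell `pub-symmetroid`, 2026-08-27) toward the registered stubs of
`Cruxes/TropicalB/Lines/birth.lean` (crux `TropicalB`, item `stmt-ValiantsHypothesis-19771`), on the WALK-DESIGN route of the `K = 4`
growth fork (D2).  Two corollaries of the halving inequality `ParamLines.chainBound_glue` (p490386, val-sym-trop-p1 g4), recorded because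
they locate exactly where linear growth stops being automatic:

* **`chainBound_series`** — SERIES composition (glue over ONE middle state): chain bound `N₁ + N₂ − 1`;
* **`chainBound_parallel`** — PARALLEL composition (disjoint union of two families, each member keeps its own line): chain bound
  `N₁ + N₂`, where `Nᵢ` bounds the chains of the `i`-th part.

Iterating: every line family assembled from single lines by series and parallel composition — the source–sink path families of
two-terminal SERIES–PARALLEL parametric graphs — has chain bound at most the number of atoms, i.e. a number of cheapest-walk
breakpoints LINEAR in the number of arcs ([folklore]; the Minkowski-sum / union laws for upper hulls).  The seat's memo
HOME/val-sym-trop-p1/g5/WALK-WIDTH-g5.md §3.5 uses this as the base line: the width-two LAYERED graph (K₂,₂ per layer, a `K₄` minor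
after two layers) is the first family NOT covered by these two laws, and there linearity is the open CONJECTURE W2 (numerically
`≈ 3T`), while Gusfield's recursion (`chainBound_walkFam`, p490642) only gives `4^⌈log₂ T⌉`.  Nothing here bears on `TropicalB` in
its window, `WeakLifting`, the doors, `MatrixDescartes` (`stmt-ValiantsHypothesis-18050`) or VP ≠ VNP.
-/

set_option linter.dupNamespace false -- the mandated D-0017 path `…ValiantsHypothesis.ValiantsHypothesis…` repeats a component
set_option autoImplicit false

namespace Summit.ValiantsHypothesis.ValiantsHypothesis.Theorems.KPlusLogSqLaw

namespace ParamLines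

/-! ## Parallel composition -/

section Parallel

variable {ι : Type*}

/-- **PARALLEL LAW.**  Split a line family by a two-valued label `side`.  If the sub-family with label `true` has chain bound
`N₁` and the one with label `false` has chain bound `N₂` (each with ITS OWN members' lines, minimality tested inside the sub-family),
then the whole family has chain bound `N₁ + N₂`: along a chain of cheapest members the members of each side form a chain of that
side.  (Glue over the two «middle states» `true/false` with a one-line second factor.) [folklore] -/
theorem chainBound_parallel (a b : ι → ℝ) (side : ι → Bool) (N₁ N₂ : ℕ)
    (h₁ : ChainBound (fun x : {z : ι // side z = true} => a x.1) (fun x => b x.1) N₁)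
    (h₂ : ChainBound (fun x : {z : ι // side z = false} => a x.1) (fun x => b x.1) N₂) :
    ChainBound a b (N₁ + N₂) := by
  classical
  -- glue: first half = the member itself (middle state = its side), second half = the side, carrying the zero line
  have hg := chainBound_glue (ι := ι) (X := ι) (Y := Bool) (W := Bool) a b a b (fun _ => (0 : ℝ)) (fun _ => (0 : ℝ))
    id side side id (fun _ => rfl) (fun z => by simp) (fun z => by simp)
    (fun x y hxy => ⟨x, rfl, hxy⟩) (fun w => if w then N₁ else N₂) (fun _ => 1)
    (fun w => by
      cases w
      · simpa using h₂
      · simpa using h₁)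
    (fun w => chainBound_one_of_subsingleton _ _ (fun _ _ => rfl))
  have hsum : (∑ w : Bool, ((if w then N₁ else N₂) + 1 - 1)) = N₁ + N₂ := by
    simp
  rw [hsum] at hg
  exact hg

end Parallel

/-! ## Series composition -/

section Series

variable {ι X Y : Type*}

/-- **SERIES LAW.**  If every member of `ι` is glued from a first half in `X` and a second half in `Y` (lines add; every pair
occurs), and `X`, `Y` have chain bounds `N₁`, `N₂`, then `ι` has chain bound `N₁ + N₂ − 1` (glue over a single middle state).
[folklore] -/
theorem chainBound_series (a b : ι → ℝ) (a₁ b₁ : X → ℝ) (a₂ b₂ : Y → ℝ) (fst : ι → X) (snd : ι → Y)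
    (ha : ∀ z, a z = a₁ (fst z) + a₂ (snd z)) (hb : ∀ z, b z = b₁ (fst z) + b₂ (snd z))
    (hglue : ∀ x y, ∃ z, fst z = x ∧ snd z = y) (N₁ N₂ : ℕ)
    (h₁ : ChainBound a₁ b₁ N₁) (h₂ : ChainBound a₂ b₂ N₂) :
    ChainBound a b (N₁ + N₂ - 1) := by
  classical
  have hg := chainBound_glue (W := Unit) a b a₁ b₁ a₂ b₂ fst snd (fun _ => ()) (fun _ => ()) (fun _ => rfl) ha hb
    (fun x y _ => hglue x y) (fun _ => N₁) (fun _ => N₂)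
    (fun _ => h₁.of_surjLines (fun x => x.1) (fun _ => rfl) (fun _ => rfl) (fun x => ⟨⟨x, rfl⟩, rfl⟩))
    (fun _ => h₂.of_surjLines (fun y => y.1) (fun _ => rfl) (fun _ => rfl) (fun y => ⟨⟨y, rfl⟩, rfl⟩))
  simpa using hg

end Series

/-! ## Atoms -/

section Atoms

variable {ι : Type*}

/-- a family all of whose members have the same slope (in particular a single line) has chain bound `1`. [folklore] -/
theorem chainBound_atom (a b : ι → ℝ) (s : ℝ) (hs : ∀ z, b z = s) : ChainBound a b 1 :=
  chainBound_one_of_subsingleton a b (fun z z' => by rw [hs z, hs z'])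

/-- **Two atoms in parallel**: a two-line family has chain bound `2` (at most one breakpoint). [folklore] -/
theorem chainBound_pair (a b : Bool → ℝ) : ChainBound a b 2 := by
  have h := chainBound_parallel a b id 1 1
    (chainBound_atom _ _ (b true) (fun x => congrArg b x.2))
    (chainBound_atom _ _ (b false) (fun x => congrArg b x.2))
  simpa using h

end Atoms

end ParamLines

end Summit.ValiantsHypothesis.ValiantsHypothesis.Theorems.KPlusLogSqLaw
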